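import Literature.Barriers.ValiantsHypothesis.ShiftedPartialsDegenerations
import Literature.Barriers.ValiantsHypothesis.ShiftedPartialsMonotone
import Literature.Barriers.ValiantsHypothesis.ShiftedPartialsTwoPowers
import Literature.Computability.AlgebraicComplexity.OrbitClosure
import HarnessLib

/-!
# Shifted partial derivatives: the permanent side of Case C4 of ELSW's Theorem 1.5

Support file for the barrier entry `ShiftedPartialDerivatives.lean` (`ShiftedPartialsCannotSeparate`,
Efremenko–Landsberg–Schenck–Weyman 2018, Thm. 1.5). ELSW §6 (Case C4) use "the crude estimate
`rank((ℓ^{n-m}perm_m)_{(k,n-k)[τ]}) ≤ Σ_{j=0}^k binom(m,j)² binom(n²+τ-1, τ)`, where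
`Σ_{j=0}^k binom(m,j)²` is the dimension of the space of partials of order `k` of `ℓ^{n-m}perm_m`, and
the `binom(n²+τ-1, τ)` is what one would have if there were no syzygies." Proved here for the tree's
`paddedPerPoly` (any field): `shiftedPartialsRank_paddedPerPoly_le_sum_mul`. Ingredients: the
no-syzygy bound `rank(f_{(k,·)[τ]}) ≤ rank(f_{k,·}) · dim S^τ` (`shiftedPartialsRank_le_mul_choose`);
the order-`k` partials of `X^a · w` lie in `Σ_{j ≤ k} X^{a-(k-j)} · ⟨∂^j w⟩`
(`iterPDeriv_X_pow_mul_mem`, `shiftedPartialsRank_zero_X_pow_mul_le`); injective renamings do not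
increase flattening ranks (`shiftedPartialsRank_zero_rename_le`); and the flattening ranks
`binom(m,j)²` of `perm_m` from `PartialDerivativesDetPerm.lean` (`flatteningRank_perPoly`), transported
to the block index type (`rename_prodMap_perPoly`).

## References

* [EfremenkoLandsbergSchenckWeyman2018] K. Efremenko, J. M. Landsberg, H. Schenck, J. Weyman, *The
  method of shifted partial derivatives cannot separate the permanent from the determinant*, Math.
  Comp. 87 (2018), §6 (Case C4).
-/

noncomputable section

namespace Literature.Barriers.ValiantsHypothesis

open MvPolynomial Literature.Computability.AlgebraicComplexity

section Crude

variable {K : Type*} [Field K] {σ : Type*} [Fintype σ] [DecidableEq σ]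

/-- The no-syzygy bound `rank(f_{(k,·)[τ]}) ≤ rank(f_{k,·}) · binom(#σ + τ - 1, τ)` ("the `binom(n²+τ-1,τ)` is
what one would have if there were no syzygies"). [cite: EfremenkoLandsbergSchenckWeyman2018, §6 (Case C4)] -/
theorem shiftedPartialsRank_le_mul_choose (k τ : ℕ) (f : MvPolynomial σ K) :
    shiftedPartialsRank K k τ f ≤
      shiftedPartialsRank K k 0 f * (Fintype.card σ + τ - 1).choose τ := by
  classical
  set V := Submodule.span K (derivSet k f) with hV
  set Mon := (Finset.univ : Finset σ).finsuppAntidiag τ with hMon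
  set W : (σ →₀ ℕ) → Submodule K (MvPolynomial σ K) := fun β =>
    V.map (LinearMap.mulLeft K (monomial β (1 : K))) with hW
  haveI hVfin : Module.Finite K V := by
    rw [hV, ← shiftedPartials_zero_right]; exact finite_span_shiftedPartials k 0 f
  have h1 : Submodule.span K (shiftedPartials k τ f) ≤ Mon.sup W := by
    rw [Submodule.span_le]
    rintro _ ⟨l, β, hl, hβ, rfl⟩
    have hβM : β ∈ Mon := (degree_eq_iff_mem_finsuppAntidiag β τ).1 hβ
    have : W β ≤ Mon.sup W := Finset.le_sup (f := W) hβM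
    refine this ⟨iterPDeriv l f, Submodule.subset_span ⟨l, hl, rfl⟩, rfl⟩
  calc shiftedPartialsRank K k τ f ≤ Module.finrank K ↥(Mon.sup W) := Submodule.finrank_mono h1
    _ ≤ ∑ β ∈ Mon, Module.finrank K (W β) := finrank_finset_sup_le_sum Mon W
    _ ≤ ∑ _β ∈ Mon, Module.finrank K V :=
        Finset.sum_le_sum fun β _ => Submodule.finrank_map_le _ _
    _ = shiftedPartialsRank K k 0 f * (Fintype.card σ + τ - 1).choose τ := by
        rw [Finset.sum_const, smul_eq_mul, mul_comm, shiftedPartialsRank_zero_eq, ← hV, hMon,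
          Finset.card_finsuppAntidiag_nat_eq_choose, Finset.card_univ]

omit [Fintype σ] in
/-- The order-`|l|` partials of a padded polynomial `X i₀ ^ a · w` lie in
`Σ_{j ≤ |l|} X i₀ ^ (a - (|l| - j)) · ⟨∂^j w⟩` (Leibniz). [folklore] -/
theorem iterPDeriv_X_pow_mul_mem (i₀ : σ) (a : ℕ) (w : MvPolynomial σ K) (l : List σ) :
    iterPDeriv l (X i₀ ^ a * w) ∈ (Finset.range (l.length + 1)).sup fun j =>
      (Submodule.span K (derivSet j w)).map
        (LinearMap.mulLeft K ((X i₀ : MvPolynomial σ K) ^ (a - (l.length - j)))) := by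
  classical
  induction l with
  | nil =>
    simp only [iterPDeriv_nil, List.length_nil, zero_add, Finset.range_one, Finset.sup_singleton,
      Nat.sub_zero, Nat.zero_sub]
    exact ⟨w, Submodule.subset_span ⟨[], rfl, rfl⟩, rfl⟩
  | cons i l ih =>
    rw [iterPDeriv_cons, List.length_cons]
    -- push `pderiv i` through the finite sup
    set F : ℕ → Submodule K (MvPolynomial σ K) := fun j => (Submodule.span K (derivSet j w)).map
      (LinearMap.mulLeft K ((X i₀ : MvPolynomial σ K) ^ (a - (l.length - j)))) with hF
    set G : ℕ → Submodule K (MvPolynomial σ K) := fun j => (Submodule.span K (derivSet j w)).map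
      (LinearMap.mulLeft K ((X i₀ : MvPolynomial σ K) ^ (a - (l.length + 1 - j)))) with hG
    have hstep : ∀ j ≤ l.length, F j ≤ ((Finset.range (l.length + 1 + 1)).sup G).comap
        (pderiv i).toLinearMap := by
      intro j hj
      rintro _ ⟨d, hd, rfl⟩
      rw [Submodule.mem_comap]
      change pderiv i ((X i₀ : MvPolynomial σ K) ^ (a - (l.length - j)) * d) ∈ _
      rw [pderiv_mul]
      refine Submodule.add_mem _ ?_ ?_
      · -- `(∂ X^b) * d`
        rw [Derivation.leibniz_pow, pderiv_X]
        by_cases hi : i₀ = i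
        · subst hi
          by_cases hb : a - (l.length - j) = 0
          · rw [hb]; simp
          · have hle : G j ≤ (Finset.range (l.length + 1 + 1)).sup G :=
              Finset.le_sup (f := G) (Finset.mem_range.2 (by omega))
            refine hle ⟨((a - (l.length - j) : ℕ) : K) • d, Submodule.smul_mem _ _ hd, ?_⟩
            simp only [LinearMap.mulLeft_apply, Pi.single_eq_same, smul_eq_mul, mul_one]
            rw [show a - (l.length + 1 - j) = a - (l.length - j) - 1 by omega, mul_smul_comm,
              ← smul_mul_assoc, ← Nat.cast_smul_eq_nsmul K]
        · have : (Pi.single (M := fun _ => MvPolynomial σ K) i 1 i₀) = 0 := by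
            rw [Pi.single_apply, if_neg hi]
          rw [this]; simp
      · -- `X^b * ∂ d` with `∂ d ∈ span derivSet (j+1)`
        have hle : G (j + 1) ≤ (Finset.range (l.length + 1 + 1)).sup G :=
          Finset.le_sup (f := G) (Finset.mem_range.2 (by omega))
        refine hle ⟨pderiv i d, ?_, ?_⟩
        · have : Submodule.span K (derivSet j w) ≤
              (Submodule.span K (derivSet (j + 1) w)).comap (pderiv i).toLinearMap := by
            rw [Submodule.span_le]
            rintro _ ⟨l', hl', rfl⟩
            simp only [SetLike.mem_coe, Submodule.mem_comap]
            exact Submodule.subset_span ⟨i :: l', by simp [hl'], by rw [iterPDeriv_cons]; rfl⟩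
          exact this hd
        · simp only [LinearMap.mulLeft_apply]
          rw [show a - (l.length + 1 - (j + 1)) = a - (l.length - j) by omega]
    have hsup : (Finset.range (l.length + 1)).sup F ≤
        ((Finset.range (l.length + 1 + 1)).sup G).comap (pderiv i).toLinearMap :=
      Finset.sup_le fun j hj => hstep j (by simpa [Nat.lt_succ_iff] using hj)
    exact hsup ih

/-- Hence `rank((X i₀ ^ a · w)_{k,·}) ≤ Σ_{j ≤ k} rank(w_{j,·})` (ELSW §6: "`Σ_{j=0}^k binom(m,j)²` is the
dimension of the space of partials of order `k` of `ℓ^{n-m}perm_m`"; we only need `≤`).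
[cite: EfremenkoLandsbergSchenckWeyman2018, §6 (Case C4)] -/
theorem shiftedPartialsRank_zero_X_pow_mul_le (i₀ : σ) (a : ℕ) (w : MvPolynomial σ K) (k : ℕ) :
    shiftedPartialsRank K k 0 (X i₀ ^ a * w) ≤
      ∑ j ∈ Finset.range (k + 1), shiftedPartialsRank K j 0 w := by
  classical
  set G : ℕ → Submodule K (MvPolynomial σ K) := fun j => (Submodule.span K (derivSet j w)).map
    (LinearMap.mulLeft K ((X i₀ : MvPolynomial σ K) ^ (a - (k - j)))) with hG
  haveI : ∀ j, Module.Finite K (Submodule.span K (derivSet j w)) := fun j => by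
    rw [← shiftedPartials_zero_right]; exact finite_span_shiftedPartials j 0 w
  have h1 : Submodule.span K (derivSet k (X i₀ ^ a * w)) ≤ (Finset.range (k + 1)).sup G := by
    rw [Submodule.span_le]
    rintro _ ⟨l, hl, rfl⟩
    have := iterPDeriv_X_pow_mul_mem (K := K) i₀ a w l
    rw [hl] at this
    exact this
  rw [shiftedPartialsRank_zero_eq]
  calc Module.finrank K (Submodule.span K (derivSet k (X i₀ ^ a * w)))
      ≤ Module.finrank K ↥((Finset.range (k + 1)).sup G) := Submodule.finrank_mono h1
    _ ≤ ∑ j ∈ Finset.range (k + 1), Module.finrank K (G j) := finrank_finset_sup_le_sum _ G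
    _ ≤ ∑ j ∈ Finset.range (k + 1), shiftedPartialsRank K j 0 w :=
        Finset.sum_le_sum fun j _ => by
          rw [shiftedPartialsRank_zero_eq]; exact Submodule.finrank_map_le _ _

omit [DecidableEq σ] in
/-- Renaming the variables injectively does not increase flattening ranks. [folklore] -/
theorem shiftedPartialsRank_zero_rename_le {σ' : Type*} [Fintype σ'] [DecidableEq σ'] {ι : σ → σ'}
    (hι : Function.Injective ι) (j : ℕ) (p : MvPolynomial σ K) :
    shiftedPartialsRank K j 0 (rename ι p) ≤ shiftedPartialsRank K j 0 p := by
  classical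
  haveI : Module.Finite K (Submodule.span K (derivSet j p)) := by
    rw [← shiftedPartials_zero_right]; exact finite_span_shiftedPartials j 0 p
  have h1 : Submodule.span K (derivSet j (rename ι p)) ≤
      (Submodule.span K (derivSet j p)).map (rename ι).toLinearMap := by
    rw [Submodule.span_le]
    rintro _ ⟨l, hl, rfl⟩
    by_cases hall : ∀ v ∈ l, v ∈ Set.range ι
    · -- `l = l₀.map ι`
      obtain ⟨l₀, rfl⟩ : ∃ l₀ : List σ, l₀.map ι = l := by
        clear hl
        induction l with
        | nil => exact ⟨[], rfl⟩
        | cons v l ih =>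
          obtain ⟨l₀, hl₀⟩ := ih (fun v hv => hall v (List.mem_cons_of_mem _ hv))
          obtain ⟨u, rfl⟩ := hall v List.mem_cons_self
          exact ⟨u :: l₀, by simp [hl₀]⟩
      rw [iterPDeriv_rename hι]
      refine ⟨iterPDeriv l₀ p, Submodule.subset_span ⟨l₀, by simpa using hl, rfl⟩, rfl⟩
    · -- some variable outside the range: the derivative vanishes
      push Not at hall
      obtain ⟨v, hv, hvr⟩ := hall
      obtain ⟨l₁, l₂, rfl⟩ := List.append_of_mem hv
      have : iterPDeriv (l₁ ++ v :: l₂) (rename ι p) = 0 := by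
        rw [iterPDeriv_append, iterPDeriv_cons, pderiv_eq_zero_of_notMem_vars, iterPDeriv_zero']
        intro hmem
        have := vars_rename _ _ (vars_iterPDeriv_subset _ _ hmem)
        rw [Finset.mem_image] at this
        obtain ⟨u, -, rfl⟩ := this
        exact hvr ⟨u, rfl⟩
      rw [SetLike.mem_coe, this]
      exact Submodule.zero_mem _
  rw [shiftedPartialsRank_zero_eq, shiftedPartialsRank_zero_eq]
  exact (Submodule.finrank_mono h1).trans (Submodule.finrank_map_le _ _)

end Crude

section Permanent

variable {K : Type*} [Field K]

/-- The generic permanent is natural under relabelling of the index set. [folklore] -/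
theorem rename_prodMap_perPoly {T T' : Type*} [Fintype T] [DecidableEq T] [Fintype T'] [DecidableEq T']
    (e : T ≃ T') : rename (Prod.map e e) (perPoly T K) = perPoly T' K := by
  simp only [perPoly, Matrix.permanent, map_sum, map_prod, Matrix.mvPolynomialX_apply, rename_X,
    Prod.map_apply]
  refine Fintype.sum_equiv (Equiv.permCongr e) _ _ fun σ => ?_
  refine Fintype.prod_equiv e _ _ fun i => ?_
  simp [Equiv.permCongr_apply]

/-- The flattening ranks of the block permanent inside the padded permanent are at most `binom(m,j)²`
(Shafiei / ELSW Prop. 4.1 via `flatteningRank_perPoly`). [cite: EfremenkoLandsbergSchenckWeyman2018, Prop. 4.1] -/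
theorem shiftedPartialsRank_zero_blockPer_le {m n : ℕ} (hmn : m ≤ n) (j : ℕ) :
    shiftedPartialsRank K j 0 (rename (fun ij : BlockIdx m n × BlockIdx m n =>
        ((ij.1 : Fin n), (ij.2 : Fin n))) (perPoly (BlockIdx m n) K)) ≤ (m.choose j) ^ 2 := by
  classical
  have hι : Function.Injective (fun ij : BlockIdx m n × BlockIdx m n =>
      ((ij.1 : Fin n), (ij.2 : Fin n))) := by
    intro a b h
    simp only [Prod.mk.injEq] at h
    exact Prod.ext (Subtype.ext h.1) (Subtype.ext h.2)
  refine (shiftedPartialsRank_zero_rename_le hι j _).trans ?_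
  set e : BlockIdx m n ≃ Fin m := Fintype.equivFinOfCardEq (card_blockIdx hmn) with he
  rw [← rename_prodMap_perPoly (K := K) e.symm, ← flatteningRank_perPoly K m j]
  exact shiftedPartialsRank_zero_rename_le (e.symm.injective.prodMap e.symm.injective) j _

/-- **The crude permanent-side bound of Case C4 (ELSW §6)**:
`rank((ℓ^{n-m}perm_m)_{(k,n-k)[τ]}) ≤ (Σ_{j=0}^{k} binom(m,j)²) · binom(n²+τ-1, τ)` — "where
`Σ_{j=0}^k binom(m,j)²` is the dimension of the space of partials of order `k` of `ℓ^{n-m}perm_m`, and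
the `binom(n²+τ-1, τ)` is what one would have if there were no syzygies". (For `j > m` the summands
vanish.) [cite: EfremenkoLandsbergSchenckWeyman2018, §6 (Case C4)] -/
theorem shiftedPartialsRank_paddedPerPoly_le_sum_mul {m n : ℕ} [NeZero n] (hmn : m ≤ n) (k τ : ℕ) :
    shiftedPartialsRank K k τ (paddedPerPoly K m n) ≤
      (∑ j ∈ Finset.range (k + 1), (m.choose j) ^ 2) * (n ^ 2 + τ - 1).choose τ := by
  classical
  refine (shiftedPartialsRank_le_mul_choose k τ _).trans ?_
  rw [Fintype.card_prod, Fintype.card_fin, ← sq]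
  refine Nat.mul_le_mul_right _ ?_
  rw [paddedPerPoly]
  refine (shiftedPartialsRank_zero_X_pow_mul_le _ _ _ k).trans ?_
  exact Finset.sum_le_sum fun j _ => shiftedPartialsRank_zero_blockPer_le hmn j

end Permanent

end Literature.Barriers.ValiantsHypothesis
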